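import Summits.ValiantsHypothesis.ValiantsHypothesis.Theorems.LacunarySymmetroidMatrixDescartesCensusEnvelopeBudget

/-!
# `MatrixDescartes` census — envelope budget, consumer form: from «20 distinct positive det-roots» to the sorted root list

HONEST FRAMING.  Object-search cell `pub-symmetroid`, door-A seat `val-sym-door-p1` (items stmt-ValiantsHypothesis-19979 `DoorA26`,
19980 `DoorA34`; OPEN, never asserted).  `…CensusEnvelopeBudget.card_traceFlips_le_three_of_twenty` takes the twenty roots as a strictly
increasing `r : Fin 20 → ℝ`.  This file derives that input from the door's own currency — a support row failure
`20 ≤ #Z₊^{distinct}` for one symmetric pencil (cf. `Census.not_doorA26_iff`) — by sorting the positive-root finset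
(`Finset.orderEmbOfFin`; the count is exactly `20` by Descartes), and restates the budget: **for every support `d`, every symmetric
six-term `2 × 2` pencil with `≥ 20` distinct positive det-roots has exactly `20` of them, `r 0 < ⋯ < r 19`, and along them the type
`sign tr F(r k)` flips at most `3` times** (`exists_sorted_roots_traceFlips_le_three`).  Nothing here bounds `ζ_sym(2,6)`, decides
`DoorA26`/`DoorA34`, or bears on `MatrixDescartes` (stmt-ValiantsHypothesis-18050) / `VP ≠ VNP`.

[folklore] Bookkeeping over the companion theorem.
-/

-- the D-0017 layout repeats a namespace component (single-conjunct summit); the `dupNamespace` linter flags it; name mandated.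
set_option linter.dupNamespace false

namespace Summit.ValiantsHypothesis.ValiantsHypothesis.Theorems.LacunarySymmetroidMatrixDescartes.Census

open Polynomial Finset
open scoped BigOperators Polynomial Matrix

/-- A six-term `2 × 2` pencil (any support, symmetric or not) with at least `20` distinct positive det-roots has EXACTLY `20`.
[folklore] -/
theorem card_posRoots_eq_twenty_of_le (d : Fin 6 → ℕ) (S : Fin 6 → Matrix (Fin 2) (Fin 2) ℝ)
    (h20 : 20 ≤ ((Matrix.det (∑ l, ((X : ℝ[X]) ^ d l) • (S l).map C)).roots.toFinset.filter (fun t => 0 < t)).card) :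
    ((Matrix.det (∑ l, ((X : ℝ[X]) ^ d l) • (S l).map C)).roots.toFinset.filter (fun t => 0 < t)).card = 20 := by
  have h1 := card_posRoots_le_countP_posRoots (Matrix.det (∑ l, ((X : ℝ[X]) ^ d l) • (S l).map C))
  have h2 := countP_posRoots_det_le_twenty d S
  omega

/-- **ENVELOPE BUDGET, consumer form** (symmetric letters, ANY support): a symmetric six-term `2 × 2` pencil with at least `20` distinct
positive det-roots has exactly twenty, enumerated increasingly as `r 0 < ⋯ < r 19` (all positive, all det-roots), and along them
`#{k < 19 : tr F(r k) · tr F(r (k+1)) < 0} ≤ 3`. [folklore] -/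
theorem exists_sorted_roots_traceFlips_le_three (d : Fin 6 → ℕ) (S : Fin 6 → Matrix (Fin 2) (Fin 2) ℝ) (hS : ∀ l, (S l).IsSymm)
    (h20 : 20 ≤ ((Matrix.det (∑ l, ((X : ℝ[X]) ^ d l) • (S l).map C)).roots.toFinset.filter (fun t => 0 < t)).card) :
    ∃ r : Fin 20 → ℝ, StrictMono r ∧ (∀ k, 0 < r k) ∧
      (∀ k, r k ∈ (Matrix.det (∑ l, ((X : ℝ[X]) ^ d l) • (S l).map C)).roots) ∧
      (Finset.univ.filter (fun k : Fin 19 =>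
        ((∑ l, r k.castSucc ^ d l • S l) 0 0 + (∑ l, r k.castSucc ^ d l • S l) 1 1) *
          ((∑ l, r k.succ ^ d l • S l) 0 0 + (∑ l, r k.succ ^ d l • S l) 1 1) < 0)).card ≤ 3 := by
  classical
  set Z := (Matrix.det (∑ l, ((X : ℝ[X]) ^ d l) • (S l).map C)).roots.toFinset.filter (fun t => 0 < t) with hZ
  have hcard : Z.card = 20 := card_posRoots_eq_twenty_of_le d S h20
  let e := Z.orderEmbOfFin hcard
  have hmem : ∀ k, e k ∈ Z := fun k => Finset.orderEmbOfFin_mem Z hcard k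
  refine ⟨e, e.strictMono, fun k => ?_, fun k => ?_, ?_⟩
  · have := hmem k; rw [hZ, Finset.mem_filter] at this; exact this.2
  · have := hmem k; rw [hZ, Finset.mem_filter, Multiset.mem_toFinset] at this; exact this.1
  · refine card_traceFlips_le_three_of_twenty d S hS e e.strictMono (fun k => ?_) (fun k => ?_)
    · have := hmem k; rw [hZ, Finset.mem_filter] at this; exact this.2
    · have := hmem k; rw [hZ, Finset.mem_filter, Multiset.mem_toFinset] at this; exact this.1

end Summit.ValiantsHypothesis.ValiantsHypothesis.Theorems.LacunarySymmetroidMatrixDescartes.Census
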